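import Summits.HodgeConjecture.HodgeConjecture.Theorems.SixfoldTableXCensusWeilCMGeneralRows
import Literature.AlgebraicGeometry.Milne1999.LefschetzCentraliserRosatiInvolution
import HarnessLib

/-!
# TABLE X rows 11 / 13, general members — the census of `SixfoldTableXCensusWeilCMGeneralRows` read in ROW VOCABULARY:
# «`End⁰(A) = ℚ(φ_E)`» (every endomorphism acts on `H¹` as a polynomial in `φ_E^*`) and a ROSATI PARTNER `φ_E† ∈ End(A)`
# replace Milne's commutant / bicommutant data (cell `pub-hodgeav-hg6`, req-37 (A) Q2b; eng-4 g6, L16b)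

HONEST FRAMING. HC, `HC_AV` (stmt-1333), `HC_CM` (stmt-3052) and H2 are NOT proved and do not occur. The census nodes X2 / X1
stay `@[conjecture]` (OURS); R-W6 and Markman₆ appear only as displayed hypotheses of §3; the GROUP hypothesis «every
`u ∈ S(A)(ℂ)` with `det(u | W) = 1` lies in `Hg(A)(ℂ)|_{H¹}`» (the GENERAL member, `Hg = U_E ∩ SU_K`) and the Rosati data are
DISPLAYED, never discharged. KERNEL ONLY: theorems over existing declarations; no definition, no `sorry`, no named fact.

WHY THIS MODULE (lead g2 2026-08-29T00:10:19Z, order (i): «the row-vocabulary lemma End⁰(A) = ℚ(φ_E) ⟹ Milne hC»). L16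
(`SixfoldTableXCensusWeilCMGeneralRows`, p680887) carries Milne's single-generator data verbatim: `hC : centralizerAlgebra A =
Subalgebra.centralizer ℂ {φ_E^*}`, `hdiag : ⨆_μ ker(φ_E^* − μ) = ⊤`, an abstract adjoint `J'` in the bicommutant with `hJQ`. The
tree ALREADY derives all three from row-level statements (Milne 1999 §1–§2 on the carriers, cell `pub-hodgecm2`):
* `Milne1999.centralizerAlgebra_eq_centralizer_singleton_of_forall_mem_adjoin` — if every `ψ^*`, `ψ ∈ End(A)`, is a polynomial in
  `φ_E^*` (e.g. `End⁰(A) = ℚ(φ_E)` a field: TABLE X rows 11 / 13, `E` quartic / sextic CM) then `hC`;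
* (`hdiag`, the diagonalisability of `φ_E^*`, is kept displayed: the tree derives it from `hC` in
  `Milne1999/LefschetzCentraliserOneGenerator` (`iSup_eigenspace_pullbackOne_eq_top_of_centralizerAlgebra_eq_centralizer_singleton`),
  a module not imported here);
* `Milne1999.pullbackOne_mem_centralizer_centralizerAlgebra` — `J' := (φ_E†)^*` lies in the bicommutant for ANY `φ_E† ∈ End(A)`.
So the row reads: `φ_E` generating the action of `End(A)` on `H¹` with `φ_E^*` diagonalisable, a Rosati partner `φ_E† ∈ End(A)` with
`Q_h(φ_E^* x, y) = Q_h(x, φ_E†^* y)` (on a CM field `E = End⁰(A)` every Rosati involution is complex conjugation — a positivity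
fact, displayed as this datum), `φ^*` a `d`-similitude of `Q_h`, and the group hypothesis. Nothing new is proved about Hodge
classes: this file only re-keys L16 (and W1) to those hypotheses.
* §1 `WeilERows.isDivisorWeilGenerated_of_generalE_of_adjoin_rosati` — W1's
  `isDivisorWeilGenerated_of_hodgeGroup_ge_unitaryCentralizer_detOne` in row vocabulary (any `n`).
* §2 `WeilERows.census_weilType_generalE_of_adjoin_rosati` (+ `_of_isIsogenous`) — L16's census, rows 11 / 13 general member.
* §3 `WeilERows.hodgeConjectureFor_weilType_generalE_of_adjoin_rosati_of_markman₆_nonsplit` — HC from {Markman₆, R-W6} alone.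
NOT COVERED: special members; the positivity facts themselves; typed ≠ proved.
-/

set_option linter.dupNamespace false

noncomputable section

open CategoryTheory
open Literature.AlgebraicGeometry Literature.AlgebraicGeometry.Motives
open Literature.AlgebraicGeometry.Motives.AbelianVariety (IsIsogenous IsSimple)
open Literature.AlgebraicGeometry.HodgeTheory
open Literature.AlgebraicGeometry.Milne1999
open Literature.AlgebraicGeometry.VanGeemen1994 (pullbackOne hodgeGroupOne detOnEigenspace)
open Literature.AlgebraicTopology.SingularHomology
open Literature.Barriers.HodgeConjecture
open Summit.HodgeConjecture.HodgeConjecture.Ring2.ClassTargets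
open Summit.HodgeConjecture.HodgeConjecture.Ring2.Motiv (ProdCMCell)
open Summit.HodgeConjecture.HodgeConjecture.Ring2.Atlas (IsQuarticFieldTypeIVFourfold)

namespace Summit.HodgeConjecture.HodgeConjecture.TableX.WeilERows

variable (A : AbelianVariety ℂ) (φ : A ⟶ A) {n : ℕ} (d : ℕ) {h : complexBetti A.X 2}

/-! ## §1 W1 in row vocabulary -/

/-- **`B• ⊆ D• + W_K` for the general type-IV member with `End⁰(A) = ℚ(φ_E)`, ROW VOCABULARY.** `dim A = 2n`, `φ² = −d`
(`d ≥ 1`); `h` rational with a Kähler multiple; every `ψ^*` (`ψ ∈ End(A)`) a `ℂ`-polynomial in `φ_E^*` («`End⁰(A) = ℚ(φ_E)`»);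
a Rosati partner `φ_E†` of `φ_E` for `Q_h`; `φ^*` a `d`-similitude of `Q_h`; and the DISPLAYED general-member hypothesis
`Hg(A) ⊇ S(A)(ℂ) ∩ SU_K`. Then `IsDivisorWeilGenerated A φ n d`. (W1 `isDivisorWeilGenerated_of_hodgeGroup_ge_unitaryCentralizer_detOne`
with Milne's `hC`, `J'`, `hJ'` derived by the tree lemmas named in the module docstring; `hdiag` displayed.)
[cite: Milne1999LefschetzClasses, §1 p. 642, Remark 1.2, §2 pp. 645–650, Thm. 3.2 and Cor. 4.5] [cite: vanGeemen1994HodgeAV, Thm. 6.12] -/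
theorem isDivisorWeilGenerated_of_generalE_of_adjoin_rosati (hn : 0 < n) (hA : A.dim = 2 * n) (hd : 0 < d)
    (hφ : φ ≫ φ = -(d • 𝟙 A)) (φE φEdag : A ⟶ A)
    (hgen : ∀ ψ : A ⟶ A, pullbackOne A ψ ∈ Algebra.adjoin ℂ {pullbackOne A φE})
    (hdiag : ⨆ μ : ℂ, Module.End.eigenspace (pullbackOne A φE) μ = ⊤)
    (hQ : IsRationalClass h) (hK : ∃ s : ℝ, 0 < s ∧ IsKaehlerClass A.dim A.X ((s : ℂ) • h))
    (hRos : ∀ x y : complexBetti A.X 1,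
      polarizationPairingOne A.X h (A.dim - 1) (pullbackOne A φE x) y =
        polarizationPairingOne A.X h (A.dim - 1) x (pullbackOne A φEdag y))
    (hφQ : ∀ x y, polarizationPairingOne A.X h (A.dim - 1) (pullbackOne A φ x) (pullbackOne A φ y) =
      (d : ℂ) • polarizationPairingOne A.X h (A.dim - 1) x y)
    (hG : ∀ (u : complexBetti A.X 1 ≃ₗ[ℂ] complexBetti A.X 1) (hu : u ∈ unitaryCentralizerGroup A h),
      detOnEigenspace u (pullbackOne A φ) (fun x ↦ (mem_centralizerGroup_iff.1 hu.1) φ x)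
        (Complex.I * (Real.sqrt d : ℂ)) = 1 → u ∈ hodgeGroupOne A.dim A.X) :
    IsDivisorWeilGenerated A φ n d :=
  have hC := centralizerAlgebra_eq_centralizer_singleton_of_forall_mem_adjoin φE hgen
  isDivisorWeilGenerated_of_hodgeGroup_ge_unitaryCentralizer_detOne A φ hn hA hd hφ φE hC
    hdiag hQ hK
    (pullbackOne A φEdag) (pullbackOne_mem_centralizer_centralizerAlgebra φEdag) hRos hφQ hG

/-! ## §2 Rows 11 / 13, general member, row vocabulary: domain membership and both census conclusions -/

/-- **TABLE X ROWS 11 / 13, GENERAL MEMBER, KERNEL VERDICT — ROW VOCABULARY.** `(A, φ)` of Weil type `(3, d)`, `A` SIMPLE and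
NOT of CM type; a rational class `h` with a Kähler multiple; `End(A)` acting on `H¹` through polynomials in one `φ_E^*`
(«`End⁰(A) = E = ℚ(φ_E)`», quartic resp. sextic CM for rows 11 / 13) with a Rosati partner `φ_E†` for `Q_h`; `φ^*` a `d`-similitude
of `Q_h`; and the DISPLAYED general-member hypothesis «`Hg(A) ⊇ S(A)(ℂ) ∩ SU_K`». Then `dim A = 6 ∧ ¬ 𝒞 A`, X2-at-`A` and
X1-at-`A` (L16 `census_weilType_generalE`). Special members NOT covered; HC / HC_AV NOT proved.
[cite: Milne1999LefschetzClasses, §2 pp. 645–650, Thm. 3.2 and Cor. 4.5] [cite: vanGeemen1994HodgeAV, Thm. 6.12 and 4.9]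
[cite: MoonenZarhin1999LowDim, (1.9) and (2.3)] -/
theorem census_weilType_generalE_of_adjoin_rosati (hW : IsWeilType A φ 3 d) (hS : IsSimple A) (hcm : ¬ IsOfCMType A)
    (φE φEdag : A ⟶ A) (hgen : ∀ ψ : A ⟶ A, pullbackOne A ψ ∈ Algebra.adjoin ℂ {pullbackOne A φE})
    (hdiag : ⨆ μ : ℂ, Module.End.eigenspace (pullbackOne A φE) μ = ⊤)
    (hQ : IsRationalClass h) (hK : ∃ s : ℝ, 0 < s ∧ IsKaehlerClass A.dim A.X ((s : ℂ) • h))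
    (hRos : ∀ x y : complexBetti A.X 1,
      polarizationPairingOne A.X h (A.dim - 1) (pullbackOne A φE x) y =
        polarizationPairingOne A.X h (A.dim - 1) x (pullbackOne A φEdag y))
    (hφQ : ∀ x y, polarizationPairingOne A.X h (A.dim - 1) (pullbackOne A φ x) (pullbackOne A φ y) =
      (d : ℂ) • polarizationPairingOne A.X h (A.dim - 1) x y)
    (hG : ∀ (u : complexBetti A.X 1 ≃ₗ[ℂ] complexBetti A.X 1) (hu : u ∈ unitaryCentralizerGroup A h),
      detOnEigenspace u (pullbackOne A φ) (fun x ↦ (mem_centralizerGroup_iff.1 hu.1) φ x)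
        (Complex.I * (Real.sqrt d : ℂ)) = 1 → u ∈ hodgeGroupOne A.dim A.X) :
    (A.dim = 6 ∧ ¬ (IsOfCMType A ∨ ProdCMCell IsQuarticFieldTypeIVFourfold (fun Z ↦ Z.dim = 2) A)) ∧
    (∀ c : complexBetti A.X (2 * 2), IsRationalClass c → IsOfHodgeType A.dim A.X (2 * 2) 2 2 c →
      c ∈ divisorClassesSpan A.X A.dim 2 ⊔ Submodule.span ℂ {w' : complexBetti A.X (2 * 2) |
        ∃ (C : AbelianVariety ℂ) (g : A.X ⟶ C.X) (w : complexBetti C.X (2 * 2)), C.dim < A.dim ∧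
          IsRationalClass w ∧ IsOfHodgeType C.dim C.X (2 * 2) 2 2 w ∧ w' = complexBetti.map g (2 * 2) w}) ∧
    (∀ c : complexBetti A.X (2 * 3), IsRationalClass c → IsOfHodgeType A.dim A.X (2 * 3) 3 3 c →
      c ∈ divisorClassesSpan A.X A.dim 3 ⊔ Submodule.span ℂ {w' : complexBetti A.X (2 * 3) |
          ∃ (a : complexBetti A.X (2 * 2)) (b : complexBetti A.X (2 * 1)),
            IsRationalClass a ∧ IsOfHodgeType A.dim A.X (2 * 2) 2 2 a ∧ IsRationalClass b ∧
            IsOfHodgeType A.dim A.X (2 * 1) 1 1 b ∧ w' = cupProduct (two_mul_add_two_mul 2 1) a b} ⊔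
        Submodule.span ℂ {w' : complexBetti A.X (2 * 3) |
          ∃ (C : AbelianVariety ℂ) (g : A.X ⟶ C.X) (w : complexBetti C.X (2 * 3)), C.dim < A.dim ∧
            IsRationalClass w ∧ IsOfHodgeType C.dim C.X (2 * 3) 3 3 w ∧ w' = complexBetti.map g (2 * 3) w} ⊔
        Submodule.span ℂ {w' : complexBetti A.X (2 * 3) |
          ∃ (B' : AbelianVariety ℂ) (g : A.X ⟶ B'.X) (d : ℕ) (ψ : B' ⟶ B') (w : complexBetti B'.X (2 * 3)),
            B'.dim = 6 ∧ 0 < d ∧ ψ ≫ ψ = -(d • 𝟙 B') ∧ IsRationalClass w ∧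
            IsOfHodgeType B'.dim B'.X (2 * 3) 3 3 w ∧ w ∈ weilClassesOf B' ψ 3 d ∧
            w' = complexBetti.map g (2 * 3) w}) :=
  have hC := centralizerAlgebra_eq_centralizer_singleton_of_forall_mem_adjoin φE hgen
  census_weilType_generalE A φ d hW hS hcm φE hC
    hdiag hQ hK
    (pullbackOne A φEdag) (pullbackOne_mem_centralizer_centralizerAlgebra φEdag) hRos hφQ hG

/-- **… on the whole ISOGENY CLASS** (L16 `census_weilType_generalE_of_isIsogenous`, row vocabulary).
[cite: Milne1999LefschetzClasses, Thm. 3.2 and Cor. 4.5] [cite: vanGeemen1994HodgeAV, Lemma 3.7 and Thm. 6.12] -/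
theorem census_weilType_generalE_of_adjoin_rosati_of_isIsogenous {A' : AbelianVariety ℂ} (hW : IsWeilType A φ 3 d)
    (hS : IsSimple A) (hcm : ¬ IsOfCMType A)
    (φE φEdag : A ⟶ A) (hgen : ∀ ψ : A ⟶ A, pullbackOne A ψ ∈ Algebra.adjoin ℂ {pullbackOne A φE})
    (hdiag : ⨆ μ : ℂ, Module.End.eigenspace (pullbackOne A φE) μ = ⊤)
    (hQ : IsRationalClass h) (hK : ∃ s : ℝ, 0 < s ∧ IsKaehlerClass A.dim A.X ((s : ℂ) • h))
    (hRos : ∀ x y : complexBetti A.X 1,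
      polarizationPairingOne A.X h (A.dim - 1) (pullbackOne A φE x) y =
        polarizationPairingOne A.X h (A.dim - 1) x (pullbackOne A φEdag y))
    (hφQ : ∀ x y, polarizationPairingOne A.X h (A.dim - 1) (pullbackOne A φ x) (pullbackOne A φ y) =
      (d : ℂ) • polarizationPairingOne A.X h (A.dim - 1) x y)
    (hG : ∀ (u : complexBetti A.X 1 ≃ₗ[ℂ] complexBetti A.X 1) (hu : u ∈ unitaryCentralizerGroup A h),
      detOnEigenspace u (pullbackOne A φ) (fun x ↦ (mem_centralizerGroup_iff.1 hu.1) φ x)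
        (Complex.I * (Real.sqrt d : ℂ)) = 1 → u ∈ hodgeGroupOne A.dim A.X)
    (hA'A : IsIsogenous A' A) :
    (A'.dim = 6 ∧ ¬ (IsOfCMType A' ∨ ProdCMCell IsQuarticFieldTypeIVFourfold (fun Z ↦ Z.dim = 2) A')) ∧
    (∀ c : complexBetti A'.X (2 * 2), IsRationalClass c → IsOfHodgeType A'.dim A'.X (2 * 2) 2 2 c →
      c ∈ divisorClassesSpan A'.X A'.dim 2 ⊔ Submodule.span ℂ {w' : complexBetti A'.X (2 * 2) |
        ∃ (C : AbelianVariety ℂ) (g : A'.X ⟶ C.X) (w : complexBetti C.X (2 * 2)), C.dim < A'.dim ∧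
          IsRationalClass w ∧ IsOfHodgeType C.dim C.X (2 * 2) 2 2 w ∧ w' = complexBetti.map g (2 * 2) w}) ∧
    (∀ c : complexBetti A'.X (2 * 3), IsRationalClass c → IsOfHodgeType A'.dim A'.X (2 * 3) 3 3 c →
      c ∈ divisorClassesSpan A'.X A'.dim 3 ⊔ Submodule.span ℂ {w' : complexBetti A'.X (2 * 3) |
          ∃ (a : complexBetti A'.X (2 * 2)) (b : complexBetti A'.X (2 * 1)),
            IsRationalClass a ∧ IsOfHodgeType A'.dim A'.X (2 * 2) 2 2 a ∧ IsRationalClass b ∧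
            IsOfHodgeType A'.dim A'.X (2 * 1) 1 1 b ∧ w' = cupProduct (two_mul_add_two_mul 2 1) a b} ⊔
        Submodule.span ℂ {w' : complexBetti A'.X (2 * 3) |
          ∃ (C : AbelianVariety ℂ) (g : A'.X ⟶ C.X) (w : complexBetti C.X (2 * 3)), C.dim < A'.dim ∧
            IsRationalClass w ∧ IsOfHodgeType C.dim C.X (2 * 3) 3 3 w ∧ w' = complexBetti.map g (2 * 3) w} ⊔
        Submodule.span ℂ {w' : complexBetti A'.X (2 * 3) |
          ∃ (B' : AbelianVariety ℂ) (g : A'.X ⟶ B'.X) (d : ℕ) (ψ : B' ⟶ B') (w : complexBetti B'.X (2 * 3)),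
            B'.dim = 6 ∧ 0 < d ∧ ψ ≫ ψ = -(d • 𝟙 B') ∧ IsRationalClass w ∧
            IsOfHodgeType B'.dim B'.X (2 * 3) 3 3 w ∧ w ∈ weilClassesOf B' ψ 3 d ∧
            w' = complexBetti.map g (2 * 3) w}) :=
  have hC := centralizerAlgebra_eq_centralizer_singleton_of_forall_mem_adjoin φE hgen
  census_weilType_generalE_of_isIsogenous A φ d hW hS hcm φE hC
    hdiag hQ hK
    (pullbackOne A φEdag) (pullbackOne_mem_centralizer_centralizerAlgebra φEdag) hRos hφQ hG hA'A

/-! ## §3 HC for the general member from the named residues, row vocabulary -/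

/-- **HC for the general member of rows 11 / 13 from {Markman₆, R-W6} ALONE, ROW VOCABULARY** (L16
`hodgeConjectureFor_weilType_generalE_of_markman₆_nonsplit`). Neither displayed hypothesis is asserted.
[cite: Markman2025SecantWeil, Thm. 1.5.1 (preprint, unrefereed)] [claim: Markman2025SurveySecant, status: under-review]
[cite: Milne1999LefschetzClasses, Cor. 4.5] [cite: vanGeemen1994HodgeAV, Thm. 6.12] -/
theorem hodgeConjectureFor_weilType_generalE_of_adjoin_rosati_of_markman₆_nonsplit
    (hMark₆ : Markman2025_weilClasses_algebraic_hyperbolicSixfold) (hRW6 : WeilTypeLadder.NonsplitSixfolds)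
    (hW : IsWeilType A φ 3 d) (φE φEdag : A ⟶ A)
    (hgen : ∀ ψ : A ⟶ A, pullbackOne A ψ ∈ Algebra.adjoin ℂ {pullbackOne A φE})
    (hdiag : ⨆ μ : ℂ, Module.End.eigenspace (pullbackOne A φE) μ = ⊤)
    (hQ : IsRationalClass h) (hK : ∃ s : ℝ, 0 < s ∧ IsKaehlerClass A.dim A.X ((s : ℂ) • h))
    (hRos : ∀ x y : complexBetti A.X 1,
      polarizationPairingOne A.X h (A.dim - 1) (pullbackOne A φE x) y =
        polarizationPairingOne A.X h (A.dim - 1) x (pullbackOne A φEdag y))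
    (hφQ : ∀ x y, polarizationPairingOne A.X h (A.dim - 1) (pullbackOne A φ x) (pullbackOne A φ y) =
      (d : ℂ) • polarizationPairingOne A.X h (A.dim - 1) x y)
    (hG : ∀ (u : complexBetti A.X 1 ≃ₗ[ℂ] complexBetti A.X 1) (hu : u ∈ unitaryCentralizerGroup A h),
      detOnEigenspace u (pullbackOne A φ) (fun x ↦ (mem_centralizerGroup_iff.1 hu.1) φ x)
        (Complex.I * (Real.sqrt d : ℂ)) = 1 → u ∈ hodgeGroupOne A.dim A.X) :
    HodgeConjectureFor A.dim A.X :=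
  have hC := centralizerAlgebra_eq_centralizer_singleton_of_forall_mem_adjoin φE hgen
  hodgeConjectureFor_weilType_generalE_of_markman₆_nonsplit A φ d hMark₆ hRW6 hW φE hC
    hdiag hQ hK
    (pullbackOne A φEdag) (pullbackOne_mem_centralizer_centralizerAlgebra φEdag) hRos hφQ hG

end Summit.HodgeConjecture.HodgeConjecture.TableX.WeilERows
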